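import Summits.ValiantsHypothesis.ValiantsHypothesis.Theses.SOSTau

/-!
# Crux `SOSTau.HutchinsonMagnification` (stmt-ValiantsHypothesis-18749), line `SketchWitness`: stub R `stub_complexToReal`
# = support item `SOSTau.ComplexToRealSOS` (stmt-ValiantsHypothesis-18750), Dutta 2021 Lemma 10

A complex weighted SOS representation `Σ_{i<s} a_i g_i² = f` of a REAL polynomial `f` yields a real one with support-sum
at most `4·Σ|supp g_i|` (in fact `3·`): write `g_i = u_i + i v_i` coefficientwise and `a_i = α_i + iβ_i`; then
`f = Σ Re(a_i g_i²) = Σ (α_i(u_i² − v_i²) − 2β_i u_i v_i) = Σ ((α_i+β_i)u_i² + (β_i−α_i)v_i² − β_i(u_i+v_i)²)`,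
and `supp u_i, supp v_i, supp (u_i+v_i) ⊆ supp g_i`.

The coefficientwise real and imaginary parts `reP p = Σ_{k ∈ supp p} C (Re p_k) X^k`, `imP p = Σ_{k ∈ supp p} C (Im p_k) X^k`
of a complex polynomial `p` are LOCAL NOTATIONS for these explicit sums (no definitions are introduced); the helper
lemmas about them live in the sub-namespace `ComplexToReal`.

References: P. Dutta, *Real τ-conjecture for sum-of-squares: a unified approach to lower bound and derandomization*,
CSR 2021 (LNCS 12730), Lemma 10.
-/

noncomputable section

set_option linter.dupNamespace false

namespace Summit.ValiantsHypothesis.ValiantsHypothesis.Theorems.SOSTauHutchinsonMagnification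

/-! ## R: Dutta 2021 Lemma 10 — a complex weighted SOS representation of a real polynomial yields a real one, support ×3 ≤ ×4 -/

section Realify

open Polynomial

-- Coefficientwise real part of a complex polynomial (local notation for an explicit sum, not a definition).
local notation:max "reP " p:max =>
  (∑ k ∈ Polynomial.support p, Polynomial.C (Complex.re (Polynomial.coeff p k)) * Polynomial.X ^ k :
    Polynomial ℝ)

-- Coefficientwise imaginary part of a complex polynomial (local notation for an explicit sum, not a definition).
local notation:max "imP " p:max =>
  (∑ k ∈ Polynomial.support p, Polynomial.C (Complex.im (Polynomial.coeff p k)) * Polynomial.X ^ k :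
    Polynomial ℝ)

namespace ComplexToReal

/-- The `k`-th coefficient of the coefficientwise real part of `p` is `Re (p.coeff k)`. -/
theorem coeff_reP (p : ℂ[X]) (k : ℕ) : (reP p).coeff k = (p.coeff k).re := by
  rw [finsetSum_coeff]
  simp only [coeff_C_mul_X_pow]
  rw [Finset.sum_ite_eq]
  by_cases hk : k ∈ p.support
  · rw [if_pos hk]
  · rw [if_neg hk, notMem_support_iff.1 hk, Complex.zero_re]

/-- The `k`-th coefficient of the coefficientwise imaginary part of `p` is `Im (p.coeff k)`. -/
theorem coeff_imP (p : ℂ[X]) (k : ℕ) : (imP p).coeff k = (p.coeff k).im := by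
  rw [finsetSum_coeff]
  simp only [coeff_C_mul_X_pow]
  rw [Finset.sum_ite_eq]
  by_cases hk : k ∈ p.support
  · rw [if_pos hk]
  · rw [if_neg hk, notMem_support_iff.1 hk, Complex.zero_im]

/-- The coefficientwise real part of `p` is supported inside `supp p`. -/
theorem support_reP_subset (p : ℂ[X]) : (reP p).support ⊆ p.support := by
  intro k hk
  rw [mem_support_iff] at hk ⊢
  rw [coeff_reP] at hk
  intro h; exact hk (by rw [h, Complex.zero_re])

/-- The coefficientwise imaginary part of `p` is supported inside `supp p`. -/
theorem support_imP_subset (p : ℂ[X]) : (imP p).support ⊆ p.support := by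
  intro k hk
  rw [mem_support_iff] at hk ⊢
  rw [coeff_imP] at hk
  intro h; exact hk (by rw [h, Complex.zero_im])

/-- `p = (Re p)_ℂ + i·(Im p)_ℂ`. -/
theorem reP_add_imP (p : ℂ[X]) :
    (reP p).map (algebraMap ℝ ℂ) + C Complex.I * (imP p).map (algebraMap ℝ ℂ) = p := by
  ext k
  rw [coeff_add, coeff_C_mul, coeff_map, coeff_map, coeff_reP, coeff_imP]
  simp only [Complex.coe_algebraMap]
  rw [mul_comm]
  exact Complex.re_add_im _

/-- The real part of `R_ℂ + i·S_ℂ` is `R`. -/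
theorem reP_map_add (R S : ℝ[X]) :
    reP (R.map (algebraMap ℝ ℂ) + C Complex.I * S.map (algebraMap ℝ ℂ)) = R := by
  ext k
  rw [coeff_reP, coeff_add, coeff_C_mul, coeff_map, coeff_map]
  simp

/-- The coefficientwise real part commutes with finite sums. -/
theorem reP_sum {ι : Type*} (s : Finset ι) (p : ι → ℂ[X]) :
    reP (∑ i ∈ s, p i) = ∑ i ∈ s, reP (p i) := by
  ext k
  rw [coeff_reP, finsetSum_coeff, finsetSum_coeff, Complex.re_sum]
  refine Finset.sum_congr rfl fun i _ => ?_
  rw [coeff_reP]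

/-- **Dutta's identity:** `Re(a·g²) = Re a·(u² − v²) − Im a·(2uv)` for `g = u_ℂ + i v_ℂ`. -/
theorem reP_C_mul_sq (a : ℂ) (g : ℂ[X]) :
    reP (C a * g ^ 2) = C a.re * (reP g ^ 2 - imP g ^ 2) - C a.im * (2 * reP g * imP g) := by
  set u := reP g
  set v := imP g
  have hg : g = u.map (algebraMap ℝ ℂ) + C Complex.I * v.map (algebraMap ℝ ℂ) := (reP_add_imP g).symm
  set U := u.map (algebraMap ℝ ℂ) with hU
  set V := v.map (algebraMap ℝ ℂ) with hV
  set J : ℂ[X] := C Complex.I with hJ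
  have hJJ : J * J = -1 := by
    rw [hJ, ← map_mul, Complex.I_mul_I, map_neg, map_one]
  have ha : C a = C (a.re : ℂ) + C (a.im : ℂ) * J := by
    conv_lhs => rw [← Complex.re_add_im a]
    rw [map_add, map_mul]
  have key : C a * g ^ 2 =
      (C a.re * (u ^ 2 - v ^ 2) - C a.im * (2 * u * v)).map (algebraMap ℝ ℂ) +
        J * (C a.im * (u ^ 2 - v ^ 2) + C a.re * (2 * u * v)).map (algebraMap ℝ ℂ) := by
    rw [hg, ha]
    simp only [Polynomial.map_add, Polynomial.map_sub, Polynomial.map_mul, Polynomial.map_pow,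
      Polynomial.map_C, Polynomial.map_ofNat, Complex.coe_algebraMap]
    rw [← hU, ← hV]
    linear_combination (C (a.re : ℂ) * V ^ 2 + 2 * C (a.im : ℂ) * U * V + C (a.im : ℂ) * J * V ^ 2) * hJJ
  rw [key, hJ, reP_map_add]

end ComplexToReal

open ComplexToReal

/-- **R = `stub_complexToReal` = support item `SOSTau.ComplexToRealSOS`:** Dutta 2021 Lemma 10 with
three real squares per complex square: `Re(a g²) = (α+β)u² + (β−α)v² − β(u+v)²`, all supported inside `supp g`,
so a complex weighted SOS representation of a real `f` gives a real one of support-sum `≤ 3·Σ|supp g_i| ≤ 4·Σ|supp g_i|`. -/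
theorem stub_complexToReal :
    Summit.ValiantsHypothesis.ValiantsHypothesis.Theses.SOSTau.ComplexToRealSOS := by
  intro f s a g hrep
  classical
  -- the real identity `f = Σ Re(a_i g_i²)`
  have hreal : f = ∑ i, (C (a i).re * (reP (g i) ^ 2 - imP (g i) ^ 2) -
      C (a i).im * (2 * reP (g i) * imP (g i))) := by
    have h : reP (∑ i, C (a i) * g i ^ 2) = reP (f.map (algebraMap ℝ ℂ)) := by rw [hrep]
    rw [reP_sum] at h
    simp only [reP_C_mul_sq] at h
    have hf : reP (f.map (algebraMap ℝ ℂ)) = f := by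
      have h0 := reP_map_add f 0
      rwa [Polynomial.map_zero, mul_zero, add_zero] at h0
    rw [hf] at h
    exact h.symm
  -- three real squares per index
  let A : Fin s × Fin 3 → ℝ := fun x =>
    ![(a x.1).re + (a x.1).im, (a x.1).im - (a x.1).re, -(a x.1).im] x.2
  let G : Fin s × Fin 3 → ℝ[X] := fun x =>
    ![reP (g x.1), imP (g x.1), reP (g x.1) + imP (g x.1)] x.2
  let e : Fin s × Fin 3 ≃ Fin (s * 3) := finProdFinEquiv
  refine ⟨s * 3, fun y => A (e.symm y), fun y => G (e.symm y), ?_, ?_⟩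
  · -- the representation
    rw [hreal, ← Equiv.sum_comp e.symm.symm (fun y => C (A (e.symm y)) * G (e.symm y) ^ 2)]
    simp only [Equiv.symm_symm, Equiv.symm_apply_apply]
    rw [Fintype.sum_prod_type]
    refine Finset.sum_congr rfl fun i _ => ?_
    simp only [A, G, Fin.sum_univ_three, Matrix.cons_val_zero, Matrix.cons_val_one, Matrix.cons_val_two,
      Matrix.head_cons, Matrix.tail_cons, map_add, map_sub, map_neg]
    ring
  · -- the support count: `Σ ≤ 3 Σ|supp g_i| ≤ 4 Σ|supp g_i|`
    rw [← Equiv.sum_comp e.symm.symm (fun y => (G (e.symm y)).support.card)]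
    simp only [Equiv.symm_symm, Equiv.symm_apply_apply]
    rw [Fintype.sum_prod_type, Finset.mul_sum]
    refine Finset.sum_le_sum fun i _ => ?_
    have hu : (reP (g i)).support.card ≤ (g i).support.card :=
      Finset.card_le_card (support_reP_subset (g i))
    have hv : (imP (g i)).support.card ≤ (g i).support.card :=
      Finset.card_le_card (support_imP_subset (g i))
    have huv : (reP (g i) + imP (g i)).support.card ≤ (g i).support.card :=
      Finset.card_le_card (support_add.trans
        (Finset.union_subset (support_reP_subset (g i)) (support_imP_subset (g i))))
    simp only [G, Fin.sum_univ_three, Matrix.cons_val_zero, Matrix.cons_val_one, Matrix.cons_val_two,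
      Matrix.head_cons, Matrix.tail_cons]
    omega

end Realify

end Summit.ValiantsHypothesis.ValiantsHypothesis.Theorems.SOSTauHutchinsonMagnification

end
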